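import Mathlib
import Summits.PneNP.PneNP.Theorems.CnfIdealGenLengthRankDefectRepresentationsCutLemmaMaxCut

/-!
# Crux `RankDefectRepresentations` (stmt-PneNP-18923), line `rank-dehn-ladder`: the COMPLETION STEP
# (tools for the registered stub `stub_bandCompletion`, RESHAPE 16, brief `Lines/rank-dehn-ladder-briefs-g16e.md` §X1;
# the stub itself is `…BandCompletion.stub_bandCompletion`)

`completion_step`: let a REFERENCE matrix `Rf` be supported on the columns `v` and carry the data `D` on the rows `w` (there
`Rf = D` on `w × v`).  A new column group `s` disjoint from `v` is COMPLETED THROUGH `Rf`: there are `W` and an error `E`, both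
supported on the columns `s`, `E` supported on the rows `w`, with `Rf * W + E = D` on `w × s` and
`rank E + rank [D|_{w × v}] ≤ rank [D|_{w × (v ∪ s)}]`, i.e. `rank E` is at most the PRIVATE DIMENSION of the group `s` on its
visible rows.  This is the column-space lift `exists_lift` of `…CutLemmaMaxCut` (p642504) followed by restriction to the new
columns.  Also the column-space bookkeeping used for the rank bound of the band matrix: `LinearMap.range (X * W).mulVecLin ≤
LinearMap.range X.mulVecLin`, subadditivity over `+` and `Σ`, and `finrank (⨆_{a∈s} T a) ≤ Σ_{a∈s} finrank (T a)`.
HONEST FRAMING: elementary linear algebra, negative-lane tool; the item (RDR) stays open; P ≠ NP is not moved; F-N2 is a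
FRONTIER formal rung.
-/

set_option linter.dupNamespace false -- `Summit.PneNP.PneNP.…`: summit = sub-problem name (D-0017)

namespace Summit.PneNP.PneNP.Theorems.CnfIdealGenLengthRankDefectRepresentationsBandCompletionStep

open Finset Matrix Module
open Summit.PneNP.PneNP.Theorems.CnfIdealGenLengthRankDefectRepresentationsCutLemmaMaxCut (exists_lift)

variable {K : Type} [Field K]

section Tools

variable {ι ι' : Type} [Fintype ι] [Fintype ι']

omit [Fintype ι] in
/-- The column space of a product `X * W` lies in the column space of `X`. [folklore] -/
theorem colSpan_mul_le (X : Matrix ι ι' K) (W : Matrix ι' ι' K) :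
    LinearMap.range (X * W).mulVecLin ≤ LinearMap.range X.mulVecLin := by
  rw [Matrix.mulVecLin_mul]; exact LinearMap.range_comp_le_range _ _

omit [Fintype ι] in
/-- The column space of a sum lies in the join of the column spaces. [folklore] -/
theorem colSpan_add_le (X Y : Matrix ι ι' K) :
    LinearMap.range (X + Y).mulVecLin ≤ LinearMap.range X.mulVecLin ⊔ LinearMap.range Y.mulVecLin := by
  rw [Matrix.mulVecLin_add]; exact LinearMap.range_add_le _ _

omit [Fintype ι] in
/-- The column space of a finite sum lies in the join of the column spaces. [folklore] -/
theorem colSpan_sum_le {α : Type} [DecidableEq α] (s : Finset α) (X : α → Matrix ι ι' K) :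
    LinearMap.range (∑ a ∈ s, X a).mulVecLin ≤ ⨆ a ∈ s, LinearMap.range (X a).mulVecLin := by
  induction s using Finset.induction_on with
  | empty => simp [Matrix.mulVecLin_zero]
  | insert a s ha ih =>
      rw [Finset.sum_insert ha, Finset.iSup_insert]
      exact (colSpan_add_le _ _).trans (sup_le_sup_left ih _)

/-- The dimension of a finite join of subspaces is at most the sum of the dimensions. [folklore] -/
theorem finrank_biSup_le {α : Type} [DecidableEq α] (s : Finset α) (T : α → Submodule K (ι → K)) :
    finrank K ↥(⨆ a ∈ s, T a) ≤ ∑ a ∈ s, finrank K ↥(T a) := by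
  induction s using Finset.induction_on with
  | empty => simp
  | insert a s ha ih =>
      rw [Finset.sum_insert ha, Finset.iSup_insert]
      exact (Submodule.finrank_add_le_finrank_add_finrank _ _).trans (Nat.add_le_add_left ih _)

variable [DecidableEq ι']

/-- **Completion step.**  Let the reference matrix `Rf` be supported on the columns `v` and carry the data `D` on the rows `w`
(there `Rf x y = D x y` for `v y`).  A new column group `s` (disjoint from `v`) is COMPLETED THROUGH `Rf`: there are `W` and an
error `E` with `Rf * W + E = D` on `w × s`, both supported on the columns `s`, `E` supported on the rows `w`, and
`rank E ≤ rank [D|_{w × (v ∪ s)}] − rank [D|_{w × v}]` (the private dimension of the group `s` on its visible rows) — the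
column-space lift `exists_lift` restricted to the new columns. [folklore] -/
theorem completion_step (Rf D : Matrix ι ι' K) (w : ι → Prop) (v s : ι' → Prop)
    [DecidablePred w] [DecidablePred v] [DecidablePred s]
    (hsv : ∀ y, s y → ¬ v y)
    (hRcol : ∀ x y, ¬ v y → Rf x y = 0) (hRrow : ∀ x y, w x → v y → Rf x y = D x y) :
    ∃ (W : Matrix ι' ι' K) (E : Matrix ι ι' K),
      (∀ x y, ¬ s y → (Rf * W) x y = 0) ∧
      (∀ x y, ¬ s y → E x y = 0) ∧
      (∀ x y, ¬ w x → E x y = 0) ∧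
      (∀ x y, w x → s y → (Rf * W) x y + E x y = D x y) ∧
      E.rank + (Matrix.of fun x y => if w x ∧ v y then D x y else 0).rank ≤
        ((Matrix.of fun x y => if w x ∧ v y then D x y else 0) +
          (Matrix.of fun x y => if w x ∧ s y then D x y else 0)).rank := by
  classical
  set Q' : Matrix ι ι' K := Matrix.of fun x y => if w x ∧ v y then D x y else 0 with hQ'
  set P' : Matrix ι ι' K := Matrix.of fun x y => if w x ∧ s y then D x y else 0 with hP'
  obtain ⟨Z, hZ⟩ := exists_lift Q' P' v
    (fun x y hy => by simp only [hQ', Matrix.of_apply]; exact if_neg fun h => hy h.2)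
    (fun x y hy => by simp only [hP', Matrix.of_apply]; exact if_neg fun h => hsv y h.2 hy)
  set Δ : Matrix ι' ι' K := Matrix.diagonal fun y => if s y then (1 : K) else 0 with hΔ
  have mulΔ : ∀ (M : Matrix ι ι' K) x y, (M * Δ) x y = if s y then M x y else 0 := by
    intro M x y
    simp only [hΔ, Matrix.mul_diagonal]
    split_ifs <;> simp
  -- on the rows `w`, `Q'` is `Rf`
  have hQrow : ∀ x, w x → ∀ y, Q' x y = Rf x y := by
    intro x hx y
    simp only [hQ', Matrix.of_apply]
    by_cases hy : v y
    · rw [if_pos ⟨hx, hy⟩, hRrow x y hx hy]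
    · rw [if_neg (fun h => hy h.2), hRcol x y hy]
  have hQZ : ∀ x, w x → ∀ y, (Q' * Z) x y = (Rf * Z) x y := by
    intro x hx y
    simp only [Matrix.mul_apply, hQrow x hx]
  refine ⟨Z * Δ, (P' - Q' * Z) * Δ, ?_, ?_, ?_, ?_, ?_⟩
  · intro x y hy
    rw [← Matrix.mul_assoc, mulΔ, if_neg hy]
  · intro x y hy
    rw [mulΔ, if_neg hy]
  · intro x y hx
    have hP0 : P' x y = 0 := by
      simp only [hP', Matrix.of_apply]; exact if_neg fun h => hx h.1
    have hQ0 : (Q' * Z) x y = 0 := by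
      simp only [Matrix.mul_apply]
      refine Finset.sum_eq_zero fun y' _ => ?_
      have : Q' x y' = 0 := by simp only [hQ', Matrix.of_apply]; exact if_neg fun h => hx h.1
      rw [this, zero_mul]
    rw [mulΔ, Matrix.sub_apply, hP0, hQ0, sub_zero]
    split_ifs <;> rfl
  · intro x y hx hy
    have hP1 : P' x y = D x y := by
      simp only [hP', Matrix.of_apply]; exact if_pos ⟨hx, hy⟩
    rw [← Matrix.mul_assoc, mulΔ, if_pos hy, mulΔ, if_pos hy, Matrix.sub_apply, hQZ x hx, hP1]
    ring
  · calc ((P' - Q' * Z) * Δ).rank + Q'.rank ≤ (P' - Q' * Z).rank + Q'.rank :=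
          Nat.add_le_add_right (Matrix.rank_mul_le_left _ _) _
      _ ≤ (Q' + P').rank := hZ

end Tools

end Summit.PneNP.PneNP.Theorems.CnfIdealGenLengthRankDefectRepresentationsBandCompletionStep
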